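import Literature.Barriers.HubbardSuperconductivity.SignProblemNPHardMachines
import Literature.Computability.Complexity.UnaryBricks
import HarnessLib

/-!
# The Karp reduction `z ↦ code (⟨n, J(toks z)⟩, -N(z))` into `ISINGGROUND` is polynomial time

Support file for the discharge of `isingGround_isNPComplete` (`SignProblemNPHard.lean`, after
Barahona 1982 [cite: Barahona1982, §4.2, Theorem (P3 is NP-hard), p. 19]; assembled in
`SignProblemNPHardProofs.lean`). The tree's proved source of `NP`-hardness is the Cook–Levin
theorem, transported by the clause-chain gadget of `SignProblemNPHardGadget.lean` to the language
`SatIsing = {z | ∃ σ, E_{J(toks z)}(σ) ≤ -N(z)}` (`satIsing_isNPHard`, `SignProblemNPHardProofs.lean`),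
whose instances are read off ARBITRARY strings `z` by the tokenizer of
`SignProblemNPHardMachines.lean`. To reach the matrix-coded language `ISINGGROUND` one more string
function is needed — the map sending `z` to the `encodingIntMatrix.pairBool encodingIntBool`-code of
the instance `(⟨n, J(toks z)⟩, -N(z))`, `n = 2L + 1`, `N(z) = P + L + m` — and this file builds it in
the tree's `FP` algebra (no machine is written):

* `uNB` — `1^{N(z)}` from the tokenizer record: `N = P + L + m` is obtained as
  `⌊(1^{2P+L} ++ 1^L) / 2⌋ ++ 1^m` (`cntB_tokFn`: the double loop of the machines file counts the
  ORDERED pairs of occurrences of one variable, `2P + L`; `Brick.halfFn` halves a length);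
* `thrCodeB` — the integer code `⟨[N ≠ 0], encodeNat N⟩ = encodingIntBool.encode (-N)`
  (`thrCodeB_tokFn`);
* `isingRedFn = ⟨matrixCodeB, thrCodeB⟩ ∘ tokFn` (`isingRedFn_mem_FP`) with
  `isingRedFn z = (encodingIntMatrix.pairBool encodingIntBool).encode (⟨n, matrixOf z⟩, -(N z))`
  (`isingRedFn_apply`, from `matrixCodeB_tokFn`).

The Karp reduction `SatIsing ≤ₚ ISINGGROUND` itself (membership: `isUnitCoupling_J`) and the
assembly of `isingGround_isNPComplete_holds` are in `SignProblemNPHardProofs.lean`.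

## References

* F. Barahona, *On the computational complexity of Ising spin glass models*, J. Phys. A 15 (1982)
  3241–3253, §4.2, "Theorem. P3 is NP-hard" (p. 19 of the journal pagination 3241+; PDF p. 19).
* M. Troyer, U.-J. Wiese, PRL 94 (2005) 170201, Letter p. 4 (the decision version used).
* S. Arora, B. Barak, *Computational Complexity: A Modern Approach*, CUP 2009, §0.1 (codes), §1.3
  (closure of polynomial time under composition), Def. 2.7 (Karp reductions).
-/

noncomputable section

namespace Literature.Barriers.HubbardSuperconductivity

open _root_.Computability Literature.Computability.Complexity Brick HashBricks OracleCompose PRelSigma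
  Polynomial

namespace CNFIsing

/-! ### The threshold magnitude in unary: `1^{N(z)}` -/

/-- `1^{N}`, `N = P + L + m`, from the tokenizer output record: `⌊(1^{2P+L} 1^L)/2⌋ 1^m`. [folklore] -/
def uNB : List Bool → List Bool :=
  concatFn ∘ fanoutFn (halfFn ∘ concatFn ∘ fanoutFn cntB (nthF 6)) (nthF 7)

/-- `uNB ∈ FP`. [cite: AroraBarakCC2009, §1.3] -/
theorem uNB_mem_FP : uNB ∈ FP :=
  comp_mem_FP concatFn_mem_FP (fanoutFn_mem_FP
    (comp_mem_FP halfFn_mem_FP (comp_mem_FP concatFn_mem_FP (fanoutFn_mem_FP cntB_mem_FP (nthF_mem_FP 6))))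
    (nthF_mem_FP 7))

/-- `uNB` on the tokenizer output is `1^{N(z)}`. [folklore] -/
theorem uNB_tokFn (z : List Bool) : uNB (tokFn z) = ones (thresholdN z) := by
  simp only [uNB, Function.comp_apply, fanoutFn_apply, concatFn_boolPair, cntB_tokFn, nthF_six_tokFn,
    nthF_seven_tokFn, halfFn, List.length_replicate, thresholdN, ones, ← List.replicate_add]
  congr 1
  omega

/-! ### The code of the threshold `-N(z)` -/

/-- The `encodingIntBool`-code of `-N(z)` from the tokenizer output record: sign bit `[N ≠ 0]`,
magnitude `encodeNat N`. [cite: AroraBarakCC2009, §0.1] -/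
def thrCodeB : List Bool → List Bool :=
  fanoutFn (notFn isNilFn ∘ uNB) (popCountFn ∘ uNB)

/-- `thrCodeB ∈ FP`. [cite: AroraBarakCC2009, §1.3] -/
theorem thrCodeB_mem_FP : thrCodeB ∈ FP :=
  fanoutFn_mem_FP (comp_mem_FP (notFn_mem_FP isNilFn_mem_FP) uNB_mem_FP) (comp_mem_FP popCountFn_mem_FP uNB_mem_FP)

/-- The code of a non-positive integer `-N`: sign bit `[N ≠ 0]`, magnitude `N`. [folklore] -/
theorem encodingIntBool_encode_neg_natCast (N : ℕ) :
    encodingIntBool.encode (-(N : ℤ)) = boolPair [!decide (N = 0)] (encodeNat N) := by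
  have h : encodingIntBool.encode (-(N : ℤ)) = boolPair [decide (-(N : ℤ) < 0)] (encodeNat (-(N : ℤ)).natAbs) := rfl
  rw [h, Int.natAbs_neg, Int.natAbs_natCast]
  congr 2
  rcases Nat.eq_zero_or_pos N with h0 | hpos
  · subst h0; simp
  · rw [decide_eq_true (by omega : -(N : ℤ) < 0)]
    simp [Nat.pos_iff_ne_zero.1 hpos]

/-- **`thrCodeB` on the tokenizer output is the code of `-N(z)`.** [folklore] -/
theorem thrCodeB_tokFn (z : List Bool) : thrCodeB (tokFn z) = encodingIntBool.encode (-(thresholdN z : ℤ)) := by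
  rw [encodingIntBool_encode_neg_natCast, thrCodeB, fanoutFn_apply, Function.comp_apply, Function.comp_apply,
    uNB_tokFn, notFn_apply (c := isNilFn) (z := ones (thresholdN z)) (b := decide (ones (thresholdN z) = [])) rfl,
    popCountFn_apply, List.count_replicate_self]
  congr 2
  simp [ones, List.replicate_eq_nil_iff]

/-! ### The reduction function -/

/-- **The reduction function** `z ↦ ⟨code ⟨n, J(toks z)⟩, code (-N(z))⟩`: the
`encodingIntMatrix.pairBool encodingIntBool`-code of the `ISINGGROUND` instance read off `z`.
[cite: Barahona1982, §4.2, Theorem (P3 is NP-hard), p. 19] [cite: AroraBarakCC2009, Def. 2.7] -/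
def isingRedFn : List Bool → List Bool :=
  fanoutFn matrixCodeB thrCodeB ∘ tokFn

/-- **`isingRedFn ∈ FP`.** [cite: AroraBarakCC2009, §1.3] -/
theorem isingRedFn_mem_FP : isingRedFn ∈ FP :=
  comp_mem_FP (fanoutFn_mem_FP matrixCodeB_mem_FP thrCodeB_mem_FP) tokFn_mem_FP

/-- **Value of the reduction function**: the code of the instance `(⟨n, J(toks z)⟩, -N(z))`.
[folklore] -/
theorem isingRedFn_apply (z : List Bool) :
    isingRedFn z = (encodingIntMatrix.pairBool encodingIntBool).encode (⟨nSpins z, matrixOf z⟩, -(thresholdN z : ℤ)) := by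
  rw [isingRedFn, Function.comp_apply, fanoutFn_apply, matrixCodeB_tokFn, thrCodeB_tokFn]
  rfl

end CNFIsing

end Literature.Barriers.HubbardSuperconductivity

end
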